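/- Copyright: the b2b-balaban cell (near-miss cell 7), T⁴-continuum fan-out, NE7b CRUX team (2), leaf lineage
t4-ne7b-formalise-leaf-02 (gen 29) on the row-NE7b OWNER t4-ne7b-p1 g47's INTERFACE REQUEST NE7b IR-47-1 «DISTINCT AND BOXED
ON PASS V» (R-OWNER-47-2 (B), journal l.31988) as corrected by the located finding F-ne7bleaf02g29-1 (journal l.32013;
leaf-05's PASS + CONCUR W-ne7bleaf05-g31-1, l.32044) — PART 3 of 3, the pass-V instantiation.  Released under the licence
of the surrounding project. -/
import Summits.QuantumFields.BalabanUV.T4Continuum.Support.HistoryGenealogyJunctionV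
import Summits.QuantumFields.BalabanUV.T4Continuum.Support.HistoryGenealogyPedigreeBirths
import Summits.QuantumFields.BalabanUV.T4Continuum.Support.HistoryRealiseDistinctGuarded

/-!
# THE JUNCTION, PASS V — DISTINCT AND BOXED (IR-47-1, corrected): the births of a pass-V genealogy are the input's
new regions of their steps; `BoxedBirths` FROM the input display `RegionsInBox`; the label-guarded `DisjointJoinsL`
FROM `NewDisjoint` and the dissolved bookkeeping's `WF`

Summits-side support leaf of the T⁴-continuum cell (rung (B)+1 on a FINITE torus only; NOT infinite volume, NOT the
mass gap, NOT the Clay statement; NOT a proof of the spine estimate NE7b, which is the cell's OWN estimate, NOT PRINTED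
and NOT PROVED).  [folklore] finite combinatorics over PART 1 (`HistoryGenealogyPedigreeBirths`: LEMMAS B, D), PART 2
(`HistoryRealiseDistinctGuarded`: `DisjointJoinsL`, `disjointJoinsL_joinP`), the pedigree bricks (`pedOf`, `OrderOK`,
`toPGen_zero`∕`toPGen_succ`, `nodup_ord`, `ord_ne_nil`, `rights_ord_zero_ne_nil`, `RunInput.nodup_rights`), the pass-V
junction (`HistoryGenealogyJunctionV`: `RunInputM.pedMV`, `histV`, `InputFamily.pedV`∕`liveCV`, `wf_histV`,
`levelClausesW_histV`, `orderOK_ordOf`) and row S1c-opt's displays (`BoxedBirths`, `InBoxAt`); nothing printed is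
asserted, no `def … : Prop` fact of Bałaban's (`RegionsInBox` is a displayed INPUT condition with parameters, like
`InBoxOK`), no cite-tagged hypothesis, zero `sorry`.  B16 = [Balaban1989LargeFieldII] pp. 383–387 under audit;
locators only.

WHY (IR-47-1 and finding F-ne7bleaf02g29-1).  The OWNER asked for the VS-witness's `disjointJoins`∕`boxedBirths` field
shapes at `ped := Φ.pedV`, `cellP := id`, `liveC := Φ.liveCV` from the input displays of
`InputFamily.realisedDomainsRW_of_familyV` (+ `InBoxOK`).  As typed both are false for `pedMV` (PART 2's header and
§3 toy for (a); for (b): `InBoxOK` boxes the ANCHORS of the new regions, `BoxedBirths` every POINT of every constituent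
region — toy `N 0 = {(0,{0,−1})}`).  The corrected interface: (b′) the input display `RegionsInBox n K` (every point of
every new region of step `≤ K` boxed at its level; implies `InBoxOK` under (G-new)) DOES give `boxedBirths` in the
field shape; (a′) the six input displays DO give the label-guarded `DisjointJoinsL` in the field shape's guarded form.

WHAT.  §1 (generic bookkeeping over `ComponentHistory (Lab d)`) **`disjointJoinsL_toPGen`**: `WF` + `OrderOK` + «new
regions of ONE step pairwise disjoint» ⟹ `DisjointJoinsL ((pedOf H rnw ord).toPGen id (j, c))` for every `c ∈ comp j`
(two equal-label births in different parts are DISTINCT new regions of the SAME step, by LEMMAS B and D).  §2 pass V,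
one input `I : RunInputM d` under the six displays `hN hRm hRmS hRm2 hD hL`: **`mem_N_of_mem_pbirths_pedMV`** (births of
a live dissolved component's genealogy are input regions `∈ I.N (step)`, `step ≤ K`); the input display
**`RegionsInBox n K`** + `inBoxOK_of_regionsInBox`; **`boxedBirths_pedMV`**: `RegionsInBox n K → c ∈ histV.comp K →
BoxedBirths n I.L K (levelOf I.s K) (I.pedMV.toPGen id (K, c))`; **`disjointJoinsL_pedMV`**: `c ∈ histV.comp K →
DisjointJoinsL (I.pedMV.toPGen id (K, c))`.  §3 the family forms = the owner's two decl : type lines, corrected: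
**`InputFamily.boxedBirths_pedV`** (`hbox` ↦ `hreg : ∀ K ≥ K₀, ∀ τ ∈ T K, (Φ.run K τ).RegionsInBox n K`) and
**`InputFamily.disjointJoinsL_pedV`** (`DisjointJoins` ↦ `DisjointJoinsL`; no box condition needed).

HONEST.  Proves nothing of Bałaban's.  By-name effect on `WALL-NE7b-P1.md` §2 once the (α) assembly consumes this file:
the `boxedBirths` R-binder is DISCHARGED from the per-term input display `RegionsInBox` (R, input side, replacing
`InBoxOK`, which it implies); the `disjointJoins` R-binder is discharged in its LABEL-GUARDED form — plugging the
witness field itself waits for the owner's (R-a)∕(R-b) ruling; the unguarded display stays KNOWN FALSE AS TYPED on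
admissible inputs (PART 2 §3).  NE7b NOT proved; spine 0∕9.
HONEST DEPENDENCY (cell): continuum YM on T⁴ ⇐ BetaPertH ∧ nine spine estimates (0/9 proved); BetaPertH ⇐ (D1) ∧ (D4)
∧ CAP+tail; G-an2-4 gates asym, D1 and NE2/3/4.  This file changes none of it. -/

open Finset
open Literature.MathematicalPhysics.QuantumFieldTheory.Balaban1983to89
open Literature.MathematicalPhysics.QuantumFieldTheory.Balaban1983to89.B13ScaleTransfer
open T4PersistenceDictionary
open Summit.QuantumFields.BalabanUV.T4Continuum.HistoryAdmissible
open Summit.QuantumFields.BalabanUV.T4Continuum.HistoryRealise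
open Summit.QuantumFields.BalabanUV.T4Continuum.HistoryRealiseCells
open Summit.QuantumFields.BalabanUV.T4Continuum.HistoryZones
open Summit.QuantumFields.BalabanUV.T4Continuum.HistoryRealiseDistinct
open Summit.QuantumFields.BalabanUV.T4Continuum.HistoryRealiseDistinctGuarded
open Summit.QuantumFields.BalabanUV.T4Continuum.HistoryGen
open Summit.QuantumFields.BalabanUV.T4Continuum.HistoryGenealogyExtraction
open Summit.QuantumFields.BalabanUV.T4Continuum.HistoryGenealogyRealise
open Summit.QuantumFields.BalabanUV.T4Continuum.HistoryGenealogyPedigree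

namespace Summit.QuantumFields.BalabanUV.T4Continuum.HistoryGenealogyJunctionVDistinct

noncomputable section

open Classical

variable {d : ℕ}

/-! ## §1 The guarded display for every component's `PGen` (generic bookkeeping) -/

section Generic

variable {H : ComponentHistory (Lab d)} {rnw : ℕ → Lab d → Bool} {ord : ℕ → Lab d → List (Lab d ⊕ Lab d)}

/-- **THE GUARDED DISPLAY FOR EVERY COMPONENT'S `PGen`** (generic bookkeeping): under `WF`, an admissible order and
«new regions of ONE step pairwise disjoint», `DisjointJoinsL ((pedOf H rnw ord).toPGen id (j, c))` for `c ∈ comp j` —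
two equal-label births in different parts are distinct new regions of the same step (LEMMAS B, D). [folklore] -/
theorem disjointJoinsL_toPGen (hW : H.WF) (hO : OrderOK H ord)
    (hND : ∀ j, ∀ n ∈ H.newReg j, ∀ n' ∈ H.newReg j, n ≠ n' → Disjoint n.2 n'.2) :
    ∀ (j : ℕ) (c : Lab d), c ∈ H.comp j → DisjointJoinsL ((pedOf H rnw ord).toPGen id (j, c))
  | 0, c, hc => by
      have hne : (rights (ord 0 c)).map (fun n => PGen.birth 0 (H.cls n) (id n)) ≠ [] := by
        simpa using rights_ord_zero_ne_nil hW hO hc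
      rw [toPGen_zero H rnw ord id hc]
      refine disjointJoinsL_joinP _ _ hne (fun A hA => ?_) ?_
      · obtain ⟨n, -, rfl⟩ := List.mem_map.1 hA
        trivial
      · rw [List.pairwise_map]
        have hnd : (rights (ord 0 c)).Nodup := HistoryGenealogyInstantiate.RunInput.nodup_rights (nodup_ord hW hO hc)
        refine hnd.imp_of_mem fun {n n'} hn hn' hne => ?_
        intro b hb b' hb' _
        simp only [id, PGen.pbirths_birth, Multiset.mem_singleton] at hb hb'
        subst hb; subst hb'
        exact hND 0 n (hW.news_sub 0 c hc n (mem_news_of_inr_mem_ord hO hc ((mem_rights_iff n _).1 hn))) n'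
          (hW.news_sub 0 c hc n' (mem_news_of_inr_mem_ord hO hc ((mem_rights_iff n' _).1 hn'))) hne
  | j + 1, c, hc => by
      have hne : ((ord (j + 1) c).map fun q =>
          Sum.elim (fun p => if rnw j p = true then PGen.renew ((pedOf H rnw ord).toPGen id (j, p)) j
              else (pedOf H rnw ord).toPGen id (j, p))
            (fun n => PGen.birth (j + 1) (H.cls n) (id n)) q) ≠ [] := by
        simpa using ord_ne_nil hW hO hc
      rw [toPGen_succ H rnw ord id hc]
      -- births of an old part's entry are the births of the part's own `PGen`
      have hold : ∀ {p : Lab d} {b : PEv × Lab d}, Sum.inl p ∈ ord (j + 1) c →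
          b ∈ (Sum.elim (fun p => if rnw j p = true then PGen.renew ((pedOf H rnw ord).toPGen id (j, p)) j
              else (pedOf H rnw ord).toPGen id (j, p))
            (fun n => PGen.birth (j + 1) (H.cls n) (id n)) (Sum.inl p)).pbirths →
          p ∈ H.comp j ∧ b ∈ ((pedOf H rnw ord).toPGen id (j, p)).pbirths := fun {p b} hp hb =>
        ⟨hW.parts_sub j c hc p (mem_parts_of_inl_mem_ord hO hc hp),
          by simpa only [Sum.elim_inl, pbirths_oldPart] using hb⟩
      have hnew : ∀ {n : Lab d} {b : PEv × Lab d}, Sum.inr n ∈ ord (j + 1) c →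
          b ∈ (Sum.elim (fun p => if rnw j p = true then PGen.renew ((pedOf H rnw ord).toPGen id (j, p)) j
              else (pedOf H rnw ord).toPGen id (j, p))
            (fun n => PGen.birth (j + 1) (H.cls n) (id n)) (Sum.inr n)).pbirths →
          n ∈ H.newReg (j + 1) ∧ b = (((j + 1, 0, H.cls n) : PEv), n) := fun {n b} hn hb =>
        ⟨hW.news_sub (j + 1) c hc n (mem_news_of_inr_mem_ord hO hc hn),
          by simpa only [Sum.elim_inr, id, PGen.pbirths_birth, Multiset.mem_singleton] using hb⟩
      refine disjointJoinsL_joinP _ _ hne (fun A hA => ?_) ?_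
      · obtain ⟨q, hq, rfl⟩ := List.mem_map.1 hA
        cases q with
        | inr n => exact trivial
        | inl p =>
            have hpc : p ∈ H.comp j := hW.parts_sub j c hc p (mem_parts_of_inl_mem_ord hO hc hq)
            have ih := disjointJoinsL_toPGen hW hO hND j p hpc
            simp only [Sum.elim_inl]
            split_ifs
            · exact ih
            · exact ih
      · rw [List.pairwise_map]
        refine (nodup_ord hW hO hc).imp_of_mem fun {q q'} hq hq' hqq => ?_
        intro b hb b' hb' hl
        have hstep : PEv.step b.1 = PEv.step b'.1 := by rw [hl]
        cases q with
        | inl p =>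
            obtain ⟨hpc, hbp⟩ := hold hq hb
            obtain ⟨hb1, hb2, -⟩ := mem_newReg_of_mem_pbirths_toPGen hW hO j p hpc b hbp
            cases q' with
            | inl p' =>
                obtain ⟨hpc', hbp'⟩ := hold hq' hb'
                obtain ⟨-, hb2', -⟩ := mem_newReg_of_mem_pbirths_toPGen hW hO j p' hpc' b' hbp'
                have hpp : p ≠ p' := fun h => hqq (by rw [h])
                have hname := pbirths_name_ne_of_ne hW hO j p p' hpc hpc' hpp b hbp b' hbp'
                have hreg : b.2 ≠ b'.2 := fun h => hname ⟨hstep, h⟩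
                rw [hstep] at hb2
                exact hND _ _ hb2 _ hb2' hreg
            | inr n' =>
                obtain ⟨-, rfl⟩ := hnew hq' hb'
                simp only [PEv.step_mk] at hstep
                omega
        | inr n =>
            obtain ⟨hnN, rfl⟩ := hnew hq hb
            cases q' with
            | inl p' =>
                obtain ⟨hpc', hbp'⟩ := hold hq' hb'
                obtain ⟨hb1', -, -⟩ := mem_newReg_of_mem_pbirths_toPGen hW hO j p' hpc' b' hbp'
                simp only [PEv.step_mk] at hstep
                omega
            | inr n' =>
                obtain ⟨hnN', rfl⟩ := hnew hq' hb'
                have hnn : n ≠ n' := fun h => hqq (by rw [h])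
                exact hND (j + 1) n hnN n' hnN' hnn

end Generic

end

end Summit.QuantumFields.BalabanUV.T4Continuum.HistoryGenealogyJunctionVDistinct

/-! ## §2 Pass V, one input: births are input regions; `BoxedBirths` from `RegionsInBox`; `DisjointJoinsL` from `NewDisjoint` -/

namespace Summit.QuantumFields.BalabanUV.T4Continuum.HistoryGenealogyInstantiate

noncomputable section

open Classical
open Summit.QuantumFields.BalabanUV.T4Continuum.HistoryGenealogyJunctionVDistinct

variable {d : ℕ}

namespace RunInputM

variable {I : RunInputM d}

/-- **THE BIRTHS OF A LIVE DISSOLVED COMPONENT'S GENEALOGY ARE INPUT REGIONS OF THEIR STEPS** (pass V): for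
`c ∈ histV.comp K`, every `b ∈ (I.pedMV.toPGen id (K, c)).pbirths` has `PEv.step b.1 ≤ K`, `b.2 ∈ I.N (PEv.step b.1)`
and label `(step, 0, cls b.2)` — under the six input displays of the junction (through `wf_histV`, `orderOK_ordOf`).
[folklore] -/
theorem mem_N_of_mem_pbirths_pedMV (hN : I.NewOK) (hRm : ∀ t k, I.Rm t k ≤ I.R t)
    (hRmS : ∀ t k, I.Rm t (k + 1) ≤ I.R (t + 1)) (hRm2 : ∀ t, 2 ≤ I.Rm t 1) (hD : I.NewDisjoint) (hL : 0 < I.L)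
    {K : ℕ} {c : Lab d} (hc : c ∈ I.histV.comp K) {b : PEv × Lab d} (hb : b ∈ (I.pedMV.toPGen id (K, c)).pbirths) :
    PEv.step b.1 ≤ K ∧ b.2 ∈ I.N (PEv.step b.1) ∧ b.1 = ((PEv.step b.1, 0, I.cls b.2) : PEv) :=
  HistoryGenealogyPedigree.mem_newReg_of_mem_pbirths_toPGen (wf_histV hN hRm hD hL)
    (orderOK_ordOf (wf_histV hN hRm hD hL) (levelClausesW_histV hN hRm hRmS hRm2 hD hL)) K c hc b hb

variable (I) in
/-- **THE DISPLAYED INPUT CONDITION `RegionsInBox n K`**: every POINT of every new region of step `j ≤ K`, scaled by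
its level `L^{levelOf s K j}`, lies in the period box `[0, n·L^K)^d` of the finest torus (print: the large-field regions
are subsets of the torus' fundamental domain — a hypothesis SHAPE on OUR input, one clause stronger than `InBoxOK`,
which boxes the anchors only). [folklore] -/
def RegionsInBox (n K : ℕ) : Prop :=
  ∀ j, j ≤ K → ∀ nr ∈ I.N j, ∀ x ∈ nr.2, InBoxAt n I.L K (levelOf I.s K) j x

/-- under (G-new)'s anchored regions, `RegionsInBox` implies the junction's `InBoxOK` [folklore] -/
theorem inBoxOK_of_regionsInBox (hN : I.NewOK) {n K : ℕ} (h : I.RegionsInBox n K) : I.InBoxOK n K :=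
  fun j hj nr hnr i => h j hj nr hnr nr.1 (hN.ok j nr hnr).1 i

/-- **`boxedBirths` FOR THE DISSOLVED PROCESS, FROM THE INPUT DISPLAY** — the VS-witness's field shape
`BoxedBirths n L K (levelOf s K) ((ped K τ).toPGen id c)` at the pass-V reading of ONE input. [folklore] -/
theorem boxedBirths_pedMV (hN : I.NewOK) (hRm : ∀ t k, I.Rm t k ≤ I.R t)
    (hRmS : ∀ t k, I.Rm t (k + 1) ≤ I.R (t + 1)) (hRm2 : ∀ t, 2 ≤ I.Rm t 1) (hD : I.NewDisjoint) (hL : 0 < I.L)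
    {n K : ℕ} (hreg : I.RegionsInBox n K) {c : Lab d} (hc : c ∈ I.histV.comp K) :
    BoxedBirths n I.L K (levelOf I.s K) (I.pedMV.toPGen id (K, c)) := by
  intro b hb x hx
  obtain ⟨hle, hmem, -⟩ := mem_N_of_mem_pbirths_pedMV hN hRm hRmS hRm2 hD hL hc hb
  exact hreg _ hle _ hmem x hx

/-- **THE GUARDED DISPLAY FOR THE DISSOLVED PROCESS, FROM THE INPUT DISPLAYS** (pass V): for `c ∈ histV.comp K`,
`DisjointJoinsL (I.pedMV.toPGen id (K, c))` — from `NewDisjoint` (same-step new regions disjoint) and the dissolved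
bookkeeping's `WF` ∕ admissible order (which need the other five displays). [folklore] -/
theorem disjointJoinsL_pedMV (hN : I.NewOK) (hRm : ∀ t k, I.Rm t k ≤ I.R t)
    (hRmS : ∀ t k, I.Rm t (k + 1) ≤ I.R (t + 1)) (hRm2 : ∀ t, 2 ≤ I.Rm t 1) (hD : I.NewDisjoint) (hL : 0 < I.L)
    {K : ℕ} {c : Lab d} (hc : c ∈ I.histV.comp K) : DisjointJoinsL (I.pedMV.toPGen id (K, c)) :=
  disjointJoinsL_toPGen (wf_histV hN hRm hD hL)
    (orderOK_ordOf (wf_histV hN hRm hD hL) (levelClausesW_histV hN hRm hRmS hRm2 hD hL))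
    (fun j n hn n' hn' hne => hD j n hn n' hn' hne) K c hc

end RunInputM

namespace InputFamily

variable {ι : Type*} (Φ : InputFamily d ι)

/-- **`boxedBirths` FOR THE FAMILY, PASS V** — the owner's IR-47-1 decl : type with the per-term input display
`RegionsInBox n K` in place of `InBoxOK n K` (which it implies): `∀ K ≥ K₀, ∀ τ ∈ T K, ∀ c ∈ Φ.liveCV K τ,
BoxedBirths n Φ.L K (levelOf (Φ.s K) K) ((Φ.pedV K τ).toPGen id c)`. [folklore] -/
theorem boxedBirths_pedV (T : ℕ → Finset ι) (n K₀ : ℕ)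
    (hN : ∀ K, K₀ ≤ K → ∀ τ ∈ T K, (Φ.run K τ).NewOK)
    (hRm : ∀ K, K₀ ≤ K → ∀ τ ∈ T K, ∀ t k, (Φ.run K τ).Rm t k ≤ (Φ.run K τ).R t)
    (hRmS : ∀ K, K₀ ≤ K → ∀ τ ∈ T K, ∀ t k, (Φ.run K τ).Rm t (k + 1) ≤ (Φ.run K τ).R (t + 1))
    (hRm2 : ∀ K, K₀ ≤ K → ∀ τ ∈ T K, ∀ t, 2 ≤ (Φ.run K τ).Rm t 1)
    (hD : ∀ K, K₀ ≤ K → ∀ τ ∈ T K, (Φ.run K τ).NewDisjoint) (hL : 0 < Φ.L)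
    (hreg : ∀ K, K₀ ≤ K → ∀ τ ∈ T K, (Φ.run K τ).RegionsInBox n K) :
    ∀ K, K₀ ≤ K → ∀ τ ∈ T K, ∀ c ∈ Φ.liveCV K τ,
      BoxedBirths n Φ.L K (levelOf (Φ.s K) K) ((Φ.pedV K τ).toPGen id c) := by
  intro K hK τ hτ a ha
  obtain ⟨c, hc, rfl⟩ := Finset.mem_image.1 ha
  exact RunInputM.boxedBirths_pedMV (hN K hK τ hτ) (hRm K hK τ hτ) (hRmS K hK τ hτ) (hRm2 K hK τ hτ) (hD K hK τ hτ) hL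
    (hreg K hK τ hτ) hc

/-- **THE GUARDED DISPLAY FOR THE FAMILY, PASS V** — the owner's IR-47-1 decl : type with `DisjointJoins` replaced by
its label-guarded form: `∀ K ≥ K₀, ∀ τ ∈ T K, ∀ c ∈ Φ.liveCV K τ, DisjointJoinsL ((Φ.pedV K τ).toPGen id c)`, from the
input displays of `realisedDomainsRW_of_familyV` (no box condition needed). [folklore] -/
theorem disjointJoinsL_pedV (T : ℕ → Finset ι) (K₀ : ℕ)
    (hN : ∀ K, K₀ ≤ K → ∀ τ ∈ T K, (Φ.run K τ).NewOK)
    (hRm : ∀ K, K₀ ≤ K → ∀ τ ∈ T K, ∀ t k, (Φ.run K τ).Rm t k ≤ (Φ.run K τ).R t)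
    (hRmS : ∀ K, K₀ ≤ K → ∀ τ ∈ T K, ∀ t k, (Φ.run K τ).Rm t (k + 1) ≤ (Φ.run K τ).R (t + 1))
    (hRm2 : ∀ K, K₀ ≤ K → ∀ τ ∈ T K, ∀ t, 2 ≤ (Φ.run K τ).Rm t 1)
    (hD : ∀ K, K₀ ≤ K → ∀ τ ∈ T K, (Φ.run K τ).NewDisjoint) (hL : 0 < Φ.L) :
    ∀ K, K₀ ≤ K → ∀ τ ∈ T K, ∀ c ∈ Φ.liveCV K τ, DisjointJoinsL ((Φ.pedV K τ).toPGen id c) := by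
  intro K hK τ hτ a ha
  obtain ⟨c, hc, rfl⟩ := Finset.mem_image.1 ha
  exact RunInputM.disjointJoinsL_pedMV (hN K hK τ hτ) (hRm K hK τ hτ) (hRmS K hK τ hτ) (hRm2 K hK τ hτ) (hD K hK τ hτ)
    hL hc

end InputFamily

end

end Summit.QuantumFields.BalabanUV.T4Continuum.HistoryGenealogyInstantiate
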